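import Summits.QuantumFields.BalabanUV.Beta.GAN24.ContactLambdaCommutator
import Summits.QuantumFields.BalabanUV.Beta.GAN24.SymLinKernelExpansion

/-!
# `BalabanUV.Beta.GAN24.SymContactLambdaCommutator` — binder row G-an2-4 ∕ (CONV-C), TRANSFER-III, the (III′) S-slot (b) of the END, born-Λ contact letter `hCg` (road-P2 M.104's
# 3rd hypothesis), TABLE HALF («mksym lane»), PART 3: **THE GAUGE-WEIGHTED `q¹_sym`-PAIRING IS A COMMUTATOR OF an1's (0.4)-SYMMETRISED ROOTED AVERAGING WITH THE BOND MEAN OF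
# THE GAUGE FUNCTION** — the twin of leaf-02 g48's `ContactLambdaCommutator.tsum_sum_mul_gaugeWeight_mul_linKerAt` with `linKerAt ↦ symLinKerAt`, `linAvgAt ↦ symLinAvgAt` and the
# normalisation `q¹_sym = symLinCountAt ∕ ((d+1)!·L^{d+1})` of an1's kernel (leaf-02 g55's `SymLinKernelExpansion.tsum_sum_symLinKerAt_mul ∕ summable_sum_symLinKerAt_mul`)
# (G-an2-4 CRUX TEAM (2), leaf prover `b2b-balaban-gan24-formalise-leaf-01`, gen 90)

WHAT IS PROVED (generic `d`, box root `ρ = toSite r`; [folklore]):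
* `tsum_sum_mul_symLinKerAt` (the 1-form on the left), **`tsum_sum_mul_gaugeWeight_mul_symLinKerAt`**
  `Σ'_x Σ_α A α x·(w₄(ψ; α,x; μ,y)·q¹_sym,ρ_{(μ,y)}(α,x)∕2) = (2·((d+1)!·L^{d+1}))⁻¹·(symLinAvgAt ρ (ψ̄•A) L μ y − Ψ̄_ρ(μ,y)·symLinAvgAt ρ A L μ y)`.
The letters of the four-site weight (`abs_gaugeWeight_le`, `prox_of_near`, `abs_sub_le_mul_l1_of_dz`) are table-free and are leaf-02's BY NAME.
NOT HERE: the cells (PARTs 5–7), any count.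

NOT IN PRINT; OUR BOOKKEEPING ([folklore]; 0 `def`, 0 cited fact, 0 `def … : Prop`, 0 sorry).  HONEST FRAMING (cell contract, verbatim): «discharging `BetaPertH` makes
Bałaban's UV stability UNCONDITIONAL — a real constructive-QFT result; it is NOT the continuum limit and NOT the Clay problem.»  HONEST DEPENDENCY (verbatim): «continuum YM
on T⁴ ⇐ BetaPertH ∧ nine spine estimates (0/9 proved); BetaPertH ⇐ (D1) ∧ (D4) ∧ CAP+tail; G-an2-4 gates asym, D1 and NE2/3/4.»  Discharges NO letter of M.104 by itself;
NEVER «G-an2-4 closed» as (CONV-C); NOT D1, NOT `BetaPertH`, NOT continuum, NOT Clay.  2026-08-28; no existing file touched.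
-/

open Finset
open scoped BigOperators Nat
open Literature.MathematicalPhysics.QuantumFieldTheory.Balaban1983to89
open Literature.MathematicalPhysics.QuantumFieldTheory.Balaban1983to89.Beta
open AffineAveraging AveragingContours AveragingHessianKernels AveragingContoursRooted
open Summit.QuantumFields.BalabanUV.Beta.SymmetrisedAxialPotential (symLinAvgAt)
open Summit.QuantumFields.BalabanUV.Beta.SymAveragingHessianCounts (symLinCountAt symLinKerAt)
open Summit.QuantumFields.BalabanUV.Beta.GAN24.SymLinKernelExpansion (tsum_sum_symLinKerAt_mul summable_sum_symLinKerAt_mul)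

noncomputable section

namespace Summit.QuantumFields.BalabanUV.Beta.GAN24.SymContactLambdaCommutator

variable {d : ℕ} {L : ℕ} {r : Fin (d + 1) → ℕ}

/-- [folklore] The `q¹_sym`-pairing with the 1-form on the left: `Σ'_x Σ_α A α x·q¹_sym(α,x) = ((d+1)!·L^{d+1})⁻¹·symLinAvgAt ρ A L μ y`. -/
theorem tsum_sum_mul_symLinKerAt (hr : r ∈ box (d + 1) L) (A : Form1 (d + 1) ℝ) (μ : Fin (d + 1)) (y : Fin (d + 1) → ℤ) :
    ∑' x, ∑ α, A α x * symLinKerAt (toSite r) L μ y (α, x)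
      = ((((d + 1).factorial : ℕ) : ℝ) * (L : ℝ) ^ (d + 1))⁻¹ * symLinAvgAt (toSite r) A L μ y := by
  rw [← tsum_sum_symLinKerAt_mul hr A μ y]
  exact tsum_congr fun x => Finset.sum_congr rfl fun α _ => mul_comm _ _

/-- NOT IN PRINT; OUR BOOKKEEPING.  **THE GAUGE-WEIGHTED `q¹_sym`-PAIRING IS A COMMUTATOR** (box root; every `ψ`, every real 1-form `A`): with the four-site weight of leaf-02 g47's
`SymHessianGaugeLegContact.tsum_dz_mul_SLam_symHessFFAt`,
`Σ'_x Σ_α A α x·((ψ x + ψ(x + e_α) − ψ(L·y + ρ) − ψ(L·y + ρ + L·e_μ))·q¹_sym,ρ_{(μ,y)}(α, x)∕2)`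
`= (2·((d+1)!·L^{d+1}))⁻¹·(symLinAvgAt ρ (ψ̄•A) L μ y − Ψ̄_ρ(μ, y)·symLinAvgAt ρ A L μ y)` — `[𝒬^ρ_{L,sym}, ψ̄] A`. -/
theorem tsum_sum_mul_gaugeWeight_mul_symLinKerAt (hr : r ∈ box (d + 1) L) (ψ : (Fin (d + 1) → ℤ) → ℝ) (A : Form1 (d + 1) ℝ)
    (μ : Fin (d + 1)) (y : Fin (d + 1) → ℤ) :
    ∑' x, ∑ α, A α x *
        ((ψ x + ψ (x + unitVec α) - ψ ((L : ℤ) • y + toSite r) - ψ ((L : ℤ) • y + toSite r + (L : ℤ) • unitVec μ))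
          * symLinKerAt (toSite r) L μ y (α, x) / 2)
      = (2 * ((((d + 1).factorial : ℕ) : ℝ) * (L : ℝ) ^ (d + 1)))⁻¹ *
          (symLinAvgAt (toSite r) (fun α x => (ψ x + ψ (x + unitVec α)) * A α x) L μ y
            - (ψ ((L : ℤ) • y + toSite r) + ψ ((L : ℤ) • y + toSite r + (L : ℤ) • unitVec μ)) * symLinAvgAt (toSite r) A L μ y) := by
  set Ψ : ℝ := ψ ((L : ℤ) • y + toSite r) + ψ ((L : ℤ) • y + toSite r + (L : ℤ) • unitVec μ) with hΨ
  have h1 := tsum_sum_symLinKerAt_mul hr (fun α x => (ψ x + ψ (x + unitVec α)) * A α x) μ y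
  have h2 := tsum_sum_symLinKerAt_mul hr A μ y
  have hs1 := summable_sum_symLinKerAt_mul hr (fun α x => (ψ x + ψ (x + unitVec α)) * A α x) μ y
  have hs2 := summable_sum_symLinKerAt_mul hr A μ y
  have hpt : ∀ x, ∑ α, A α x *
      ((ψ x + ψ (x + unitVec α) - ψ ((L : ℤ) • y + toSite r) - ψ ((L : ℤ) • y + toSite r + (L : ℤ) • unitVec μ))
        * symLinKerAt (toSite r) L μ y (α, x) / 2)
      = (1 / 2) * (∑ α, symLinKerAt (toSite r) L μ y (α, x) * ((ψ x + ψ (x + unitVec α)) * A α x))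
          - (Ψ / 2) * ∑ α, symLinKerAt (toSite r) L μ y (α, x) * A α x := by
    intro x
    rw [Finset.mul_sum, Finset.mul_sum, ← Finset.sum_sub_distrib]
    refine Finset.sum_congr rfl fun α _ => ?_
    rw [hΨ]; ring
  rw [tsum_congr hpt, (hs1.mul_left _).tsum_sub (hs2.mul_left _), tsum_mul_left, tsum_mul_left, h1, h2]
  have hL : (2 * ((((d + 1).factorial : ℕ) : ℝ) * (L : ℝ) ^ (d + 1)))⁻¹ = (1 / 2) * ((((d + 1).factorial : ℕ) : ℝ) * (L : ℝ) ^ (d + 1))⁻¹ := by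
    rw [mul_inv, one_div]
  rw [hL]; ring

end Summit.QuantumFields.BalabanUV.Beta.GAN24.SymContactLambdaCommutator

end
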